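import Summits.Ventures.HSemireg.WedgeHankelRecurrenceGaussChainSequence

/-!
# Venture HSemireg — **STIELTJES' PARAMETRIZATION OF THE RECURRENCES WITH POSITIVE ZEROS (birth–death form)**: for a positive recurrence `q_0 = 1`, `q_1 = X − a_0`,
# `q_{n+2} = (X − a_{n+1}) q_{n+1} − b_{n+1} q_n`, ALL ZEROS OF `q_{t+1}` ARE POSITIVE ⇔ there are `λ_n > 0` (`n ≤ t`), `μ_0 = 0`, `μ_n > 0` (`1 ≤ n ≤ t`) with `a_n = λ_n + μ_n` and
# `b_{n+1} = λ_n μ_{n+1}` (Stieltjes' S-fraction coefficients `c_{2n+1} = λ_n`, `c_{2n} = μ_n`); then `(−1)^n q_n(0) = λ_0 λ_1 ⋯ λ_{n−1}`, and the parameters are UNIQUE: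
# `λ_n = −q_{n+1}(0)∕q_n(0)`, `μ_{n+1} = b_{n+1}∕λ_n`

HONEST FRAMING. Part of the Lean index of the computation cell `pub-hsemireg` (seat p10 gen 46, Sunday typer «UNIFORM-IN-n»).  Real polynomials and finite products only; no variety, no cohomology
theory, no sheaf, no Ext group and no semiregularity map is constructed here; nothing here says that HC / HC_CM / HC_AV holds; no Literature fact (unproved `Prop`) is declared or used.  Custodian
versions as in `WedgeHankelSiegelIdeal` (1/3).
SOURCES (cited).  T. J. Stieltjes, *Recherches sur les fractions continues*, Ann. Fac. Sci. Toulouse 8 (1894) J1–J122, §§1–11 (the S-fraction with positive coefficients); T. S. Chihara, *An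
Introduction to Orthogonal Polynomials* (1978), Ch. I §9, eq. (9.3)–(9.6) and Thm 9.1 (OPS with true interval of orthogonality in `[0, ∞)` ⇔ `c_n = γ_{2n−1} + γ_{2n}`, `λ_{n+1} = γ_{2n} γ_{2n+1}`
with positive `γ`), Ch. IV Thm 2.1; S. Karlin, J. McGregor, *The differential equations of birth-and-death processes, and the Stieltjes moment problem*, Trans. Amer. Math. Soc. 85 (1957)
489–546, §2 (birth rates `λ_n`, death rates `μ_n`, `μ_0 = 0`); H. S. Wall, *Analytic Theory of Continued Fractions* (1948), §28.
PROOF TYPED HERE.  With `u_n = (−1)^n q_n(0)`: `u_{n+2} = a_{n+1} u_{n+1} − b_{n+1} u_n`; under the parametrization `u_n = λ_0⋯λ_{n−1}` by induction, so `u_n > 0` and N372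
`recurrence_forall_eval_alt_iff` (`A = 0`) places the zeros in `(0, ∞)`; conversely positive zeros give `u_n > 0` (same bridge) and `λ_n := u_{n+1}∕u_n`, `μ_{n+1} := b_{n+1} u_n∕u_{n+1}` solve the
relations; uniqueness from `u_n = λ_0⋯λ_{n−1}`.
DEDUP DISCLOSURE (`rg -n -i 'birthDeath|birth.death|stieltjes_param|S-fraction' Summits/Ventures/HSemireg Literature`, 2026-09-03): N301 ∕ N303 `stieltjesPair` is GANTMACHER's continued
fraction (103) for Hurwitz pairs via Bezoutians (parameters `c_i, d_i` of `g∕h`), a different object and normalisation; nothing parametrizes the Jacobi recurrence coefficients.  The 5 names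
below: 0 hits tree-wide.

WHAT IS IN THE TREE.  N372 `recurrence_forall_eval_alt_iff`; N279 (recurrence shape).
THIS FILE (namespace `Summit.Ventures.HSemireg.Wedge.HankelOuter` continued; CHAINED on N372 (import); 0 definitions):
* §1138 **`recurrence_alt_eval_zero_of_birthDeath`** (`(−1)^n q_n(0) = λ_0⋯λ_{n−1}`), **`zeros_pos_of_birthDeath`** (⇐), **`birthDeath_of_zeros_pos`** (⇒, explicit parameters),
  `birthDeath_params_eq` (uniqueness), `birthDeath_chain_params` (the induced Wall–Wetzel parameters at `0`: `b_{n+1} = (1 − g_n) g_{n+1} a_n a_{n+1}` with `g_n = μ_n∕(λ_n + μ_n)`).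
CAVEATS.  Finite sections; nothing on the associated Stieltjes moment problem or continued-fraction convergence.  Nothing Ext-side.  New names only.
-/

open Module Polynomial
open scoped Matrix Polynomial

namespace Summit.Ventures.HSemireg.Wedge.HankelOuter

/-! ## §1138. Stieltjes' parameters (birth–death form) -/

/-- **`(−1)^n q_n(0) = λ_0 λ_1 ⋯ λ_{n−1}` (`n ≤ t + 1`) when `a_n = λ_n + μ_n` (`n ≤ t`, `μ_0 = 0`) and `b_{n+1} = λ_n μ_{n+1}` (`n + 1 ≤ t`).** [Chihara I (9.5); Karlin–McGregor 1957 §2; this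
file, §1138] -/
theorem recurrence_alt_eval_zero_of_birthDeath {q : ℕ → ℝ[X]} {a b : ℕ → ℝ} (hq0 : q 0 = 1) (hq1 : q 1 = Polynomial.X - C (a 0))
    (hrec : ∀ n, q (n + 2) = (Polynomial.X - C (a (n + 1))) * q (n + 1) - C (b (n + 1)) * q n) {t : ℕ} {l m : ℕ → ℝ} (hm0 : m 0 = 0)
    (ha : ∀ n, n ≤ t → a n = l n + m n) (hbn : ∀ n, n + 1 ≤ t → b (n + 1) = l n * m (n + 1)) :
    ∀ n, n ≤ t + 1 → (-1 : ℝ) ^ n * (q n).eval 0 = ∏ k ∈ Finset.range n, l k := by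
  have key : ∀ n, n ≤ t → (-1 : ℝ) ^ n * (q n).eval 0 = ∏ k ∈ Finset.range n, l k ∧ (-1 : ℝ) ^ (n + 1) * (q (n + 1)).eval 0 = ∏ k ∈ Finset.range (n + 1), l k := by
    intro n
    induction n with
    | zero =>
      intro _
      refine ⟨by rw [hq0, eval_one, pow_zero, one_mul, Finset.prod_range_zero], ?_⟩
      rw [hq1, eval_sub, eval_X, eval_C, Finset.prod_range_one, ha 0 (Nat.zero_le _), hm0]
      ring
    | succ n ih =>
      intro hn
      obtain ⟨h0, h1⟩ := ih (by omega)
      refine ⟨h1, ?_⟩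
      have h1' : (-1 : ℝ) ^ (n + 1) * (q (n + 1)).eval 0 = (-1 : ℝ) ^ n * (q n).eval 0 * l n := by rw [h1, Finset.prod_range_succ, h0]
      rw [show n + 1 + 1 = n + 2 from rfl, hrec n, eval_sub, eval_mul, eval_mul, eval_sub, eval_X, eval_C, eval_C, Finset.prod_range_succ, ← h1, ha (n + 1) hn, hbn n hn]
      linear_combination (m (n + 1)) * h1'
  intro n hn
  rcases n with _ | k
  · rw [hq0, eval_one, pow_zero, one_mul, Finset.prod_range_zero]
  · exact (key k (by omega)).2

/-- **STIELTJES (⇐): positive birth–death parameters (`λ_n > 0` for `n ≤ t`, `μ_0 = 0`, `μ_{n+1} > 0`) put every zero of `q_{t+1}` in `(0, ∞)`.** [Stieltjes 1894; Chihara I Thm 9.1; this file,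
§1138] -/
theorem zeros_pos_of_birthDeath {q : ℕ → ℝ[X]} {a b : ℕ → ℝ} (hq0 : q 0 = 1) (hq1 : q 1 = Polynomial.X - C (a 0))
    (hrec : ∀ n, q (n + 2) = (Polynomial.X - C (a (n + 1))) * q (n + 1) - C (b (n + 1)) * q n) (hb : ∀ j, 0 < b j) {t : ℕ} {l m : ℕ → ℝ} (hm0 : m 0 = 0)
    (hl : ∀ n, n ≤ t → 0 < l n) (ha : ∀ n, n ≤ t → a n = l n + m n) (hbn : ∀ n, n + 1 ≤ t → b (n + 1) = l n * m (n + 1)) :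
    ∀ s, (q (t + 1)).eval s = 0 → 0 < s := by
  refine (recurrence_forall_eval_alt_iff hq0 hq1 hrec hb t 0).1 fun k hk => ?_
  rw [recurrence_alt_eval_zero_of_birthDeath hq0 hq1 hrec hm0 ha hbn k hk]
  exact Finset.prod_pos fun j hj => hl j (by have := Finset.mem_range.1 hj; omega)

/-- **STIELTJES (⇒): if every zero of `q_{t+1}` is positive then, with `u_n = (−1)^n q_n(0) > 0`, the parameters `λ_n = u_{n+1}∕u_n` (`n ≤ t`), `μ_0 = 0`, `μ_{n+1} = b_{n+1} u_n∕u_{n+1}` are positive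
and satisfy `a_n = λ_n + μ_n`, `b_{n+1} = λ_n μ_{n+1}`.** [Stieltjes 1894; Chihara I Thm 9.1, IV Thm 2.1; Karlin–McGregor 1957; this file, §1138] -/
theorem birthDeath_of_zeros_pos {q : ℕ → ℝ[X]} {a b : ℕ → ℝ} (hq0 : q 0 = 1) (hq1 : q 1 = Polynomial.X - C (a 0))
    (hrec : ∀ n, q (n + 2) = (Polynomial.X - C (a (n + 1))) * q (n + 1) - C (b (n + 1)) * q n) (hb : ∀ j, 0 < b j) {t : ℕ}
    (h : ∀ s, (q (t + 1)).eval s = 0 → 0 < s) :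
    ∃ l m : ℕ → ℝ, m 0 = 0 ∧ (∀ n, n ≤ t → 0 < l n) ∧ (∀ n, n + 1 ≤ t → 0 < m (n + 1)) ∧ (∀ n, n ≤ t → a n = l n + m n) ∧
      (∀ n, n + 1 ≤ t → b (n + 1) = l n * m (n + 1)) ∧ ∀ n, n ≤ t → l n = -(q (n + 1)).eval 0 / (q n).eval 0 := by
  have hpos := (recurrence_forall_eval_alt_iff hq0 hq1 hrec hb t 0).2 h
  -- `u_n := (−1)^n q_n(0)`
  obtain ⟨u, hu⟩ : ∃ u : ℕ → ℝ, u = fun n => (-1 : ℝ) ^ n * (q n).eval 0 := ⟨_, rfl⟩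
  have hun : ∀ n, u n = (-1 : ℝ) ^ n * (q n).eval 0 := fun n => by rw [hu]
  have hupos : ∀ n, n ≤ t + 1 → 0 < u n := fun n hn => by rw [hun]; exact hpos n hn
  have hu1 : u 1 = a 0 * u 0 := by rw [hun, hun, hq0, hq1, eval_one, eval_sub, eval_X, eval_C]; ring
  have hu2 : ∀ n, u (n + 2) = a (n + 1) * u (n + 1) - b (n + 1) * u n := fun n => by
    rw [hun, hun, hun, hrec n, eval_sub, eval_mul, eval_mul, eval_sub, eval_X, eval_C, eval_C]; ring
  refine ⟨fun n => u (n + 1) / u n, fun n => if n = 0 then 0 else b n * u (n - 1) / u n, if_pos rfl, fun n hn => div_pos (hupos (n + 1) (by omega)) (hupos n (by omega)),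
    fun n hn => ?_, fun n hn => ?_, fun n hn => ?_, fun n hn => ?_⟩
  · show 0 < (if n + 1 = 0 then (0 : ℝ) else b (n + 1) * u (n + 1 - 1) / u (n + 1))
    rw [if_neg (Nat.succ_ne_zero n), Nat.add_sub_cancel]
    exact div_pos (mul_pos (hb _) (hupos n (by omega))) (hupos (n + 1) (by omega))
  · rcases n with _ | k
    · show a 0 = u (0 + 1) / u 0 + if (0 : ℕ) = 0 then 0 else b 0 * u (0 - 1) / u 0
      rw [if_pos rfl, add_zero, zero_add, hu1, mul_div_cancel_right₀ _ (hupos 0 (by omega)).ne']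
    · show a (k + 1) = u (k + 1 + 1) / u (k + 1) + if k + 1 = 0 then 0 else b (k + 1) * u (k + 1 - 1) / u (k + 1)
      rw [if_neg (Nat.succ_ne_zero k), Nat.add_sub_cancel, show k + 1 + 1 = k + 2 from rfl, hu2 k]
      field_simp [(hupos (k + 1) (by omega)).ne']
      ring
  · show b (n + 1) = u (n + 1) / u n * (if n + 1 = 0 then 0 else b (n + 1) * u (n + 1 - 1) / u (n + 1))
    rw [if_neg (Nat.succ_ne_zero n), Nat.add_sub_cancel]
    field_simp [(hupos (n + 1) (by omega)).ne', (hupos n (by omega)).ne']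
  · show u (n + 1) / u n = -(q (n + 1)).eval 0 / (q n).eval 0
    have hq : (q n).eval 0 ≠ 0 := fun h0 => by have := hupos n (by omega); rw [hun, h0, mul_zero] at this; exact lt_irrefl _ this
    have hpow : (-1 : ℝ) ^ n ≠ 0 := pow_ne_zero _ (by norm_num)
    rw [hun, hun, pow_succ, div_eq_div_iff (mul_ne_zero hpow hq) hq]
    ring

/-- **UNIQUENESS: positive birth–death parameters with `μ_0 = 0` are determined — `λ_n = −q_{n+1}(0)∕q_n(0)` and `μ_{n+1} = b_{n+1}∕λ_n`.** [Chihara I Thm 9.1; this file, §1138] -/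
theorem birthDeath_params_eq {q : ℕ → ℝ[X]} {a b : ℕ → ℝ} (hq0 : q 0 = 1) (hq1 : q 1 = Polynomial.X - C (a 0))
    (hrec : ∀ n, q (n + 2) = (Polynomial.X - C (a (n + 1))) * q (n + 1) - C (b (n + 1)) * q n) {t : ℕ} {l m : ℕ → ℝ} (hm0 : m 0 = 0)
    (hl : ∀ n, n ≤ t → 0 < l n) (ha : ∀ n, n ≤ t → a n = l n + m n) (hbn : ∀ n, n + 1 ≤ t → b (n + 1) = l n * m (n + 1)) :
    (∀ n, n ≤ t → l n = -(q (n + 1)).eval 0 / (q n).eval 0) ∧ ∀ n, n + 1 ≤ t → m (n + 1) = b (n + 1) / l n := by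
  have hev := recurrence_alt_eval_zero_of_birthDeath hq0 hq1 hrec hm0 ha hbn
  refine ⟨fun n hn => ?_, fun n hn => ?_⟩
  · have h0 := hev n (by omega)
    have h1 := hev (n + 1) (by omega)
    rw [Finset.prod_range_succ, ← h0, pow_succ] at h1
    have hq : (q n).eval 0 ≠ 0 := fun hz => by
      rw [hz, mul_zero] at h0
      exact (Finset.prod_pos fun j hj => hl j (by have := Finset.mem_range.1 hj; omega)).ne' h0.symm
    have hsign : ((-1 : ℝ) ^ n) ^ 2 = 1 := by rw [← pow_mul, mul_comm, pow_mul, neg_one_sq, one_pow]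
    rw [eq_div_iff hq]
    linear_combination (-(-1 : ℝ) ^ n) * h1 - ((q (n + 1)).eval 0 + (q n).eval 0 * l n) * hsign
  · rw [hbn n hn, mul_div_cancel_left₀ _ (hl n (by omega)).ne']

/-- **The induced chain sequence at `0`: `b_{n+1} = (1 − g_n) g_{n+1} · a_n a_{n+1}` with `g_n = μ_n∕(λ_n + μ_n) ∈ [0, 1)`, `g_0 = 0`** — Stieltjes' parameters are Wall–Wetzel parameters (N372) for the
end point `A = 0`. [Chihara III §5, I §9; this file, §1138] -/
theorem birthDeath_chain_params {a b l m : ℕ → ℝ} {t : ℕ} (hm0 : m 0 = 0) (hl : ∀ n, n ≤ t → 0 < l n) (hm : ∀ n, n + 1 ≤ t → 0 < m (n + 1))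
    (ha : ∀ n, n ≤ t → a n = l n + m n) (hbn : ∀ n, n + 1 ≤ t → b (n + 1) = l n * m (n + 1)) :
    (m 0 / (l 0 + m 0) = 0) ∧ (∀ n, n ≤ t → 0 ≤ m n / (l n + m n) ∧ m n / (l n + m n) < 1) ∧
      ∀ n, n + 1 ≤ t → b (n + 1) = (1 - m n / (l n + m n)) * (m (n + 1) / (l (n + 1) + m (n + 1))) * ((a n - 0) * (a (n + 1) - 0)) := by
  have hmnn : ∀ n, n ≤ t → 0 ≤ m n := fun n hn => by
    rcases n with _ | k
    · rw [hm0]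
    · exact (hm k hn).le
  refine ⟨by rw [hm0, zero_div], fun n hn => ⟨div_nonneg (hmnn n hn) (by linarith [hl n hn, hmnn n hn]), ?_⟩, fun n hn => ?_⟩
  · rw [div_lt_one (by linarith [hl n hn, hmnn n hn])]
    linarith [hl n hn]
  · have h0 : l n + m n ≠ 0 := by linarith [hl n (by omega), hmnn n (by omega)]
    have h1 : l (n + 1) + m (n + 1) ≠ 0 := by linarith [hl (n + 1) hn, hmnn (n + 1) hn]
    rw [hbn n hn, ha n (by omega), ha (n + 1) hn, sub_zero, sub_zero]
    field_simp
    ring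

end Summit.Ventures.HSemireg.Wedge.HankelOuter
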